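import Literature.Probability.LatticeModels.TailTrivialGibbs
import Literature.Probability.LatticeModels.IsingAutomorphismCovariance
import Literature.Probability.Percolation.ZeroOneLawMixing
import HarnessLib

/-!
# Tail triviality ⇒ short-range correlations ⇒ ergodicity under lattice shifts

Topic `Probability/LatticeModels`; theorems only. Georgii–Higuchi 2000 use, in Step 2 of the proof
of the butterfly lemma (Lemma 3.1, p. 7), that an extremal Gibbs measure which is invariant under
the translation subgroup `(ϑ_x)_{x ∈ 2ℤ²}` is ergodic for it: "our `μ` is extremal, and therefore
`(ϑ_x)_{x∈2ℤ²}`-ergodic by Proposition (14.9) of [6]" (Georgii 2011, Prop. 14.9; the mechanism is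
Georgii 2011, Prop. 7.9/Thm. 7.7(a): `μ` is tail trivial iff
`lim_{Λ↑S} sup_{B ∈ 𝓕_{Λᶜ}} |μ(A ∩ B) - μ(A)μ(B)| = 0` for every event `A` — "short-range
correlations" — and a measure-preserving shift moving cylinder events to infinity is then mixing on
cylinder events, hence ergodic). We prove exactly this chain for an arbitrary probability measure
on a countable product `V → S`:

* `IsTailTrivial.exists_finset_abs_measureReal_inter_sub_le` — **tail triviality ⇒ short-range
  correlations**: for every event `A` and `ε > 0` there is a finite `Λ` with
  `|μ(A ∩ B) - μ(A)μ(B)| ≤ ε` for all `B ∈ 𝓕_{Λᶜ}` (Lévy's downward theorem along a subsequence,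
  `Process.exists_strictMono_ae_tendsto_condExp_antitone`, the identification
  `μ(A | 𝒯) = μ(A)` of `IsTailTrivial.condExp_tailEvents_ae_eq_const`, dominated convergence);
* `IsTailTrivial.measure_eq_zero_or_one_of_preimage_coordShift_eq` — **⇒ ergodicity**: if
  moreover `μ` is preserved by the coordinate shift `ω ↦ ω ∘ g` along a map `g` whose iterates move
  every finite set of coordinates out of every finite set, every shift-invariant event is trivial
  (the tree's `measure_eq_zero_or_one_of_preimage_eq_of_mixing`, `ZeroOneLawMixing.lean`, on the
  ring of measurable cylinders);
* `IsTailTrivial.measure_eq_zero_or_one_of_shift_invariant` — the case of `ℤ^d` and the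
  relabelling `configRelabel (Site.shift v)`, `v ≠ 0` (so in particular for the subgroup `2ℤ^d`).

## References

* H.-O. Georgii, *Gibbs Measures and Phase Transitions*, 2nd ed., de Gruyter 2011, Prop. 7.9 with
  Thm. 7.7(a) (tail triviality ⇔ short-range correlations), Prop. 14.9 (extremal + invariant ⇒
  ergodic) [Georgii2011].
* H.-O. Georgii, Y. Higuchi, J. Math. Phys. 41 (2000), proof of Lemma 3.1, Step 2, p. 7
  [GeorgiiHiguchi2000].
-/

noncomputable section

open MeasureTheory Filter Topology
open Literature.Probability.Percolation (coordShift coordShift_apply coordShift_iterate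
  measurable_coordShift measure_eq_zero_or_one_of_preimage_eq_of_mixing)

namespace Literature.Probability.LatticeModels

variable {V : Type*} {S : Type*} [MeasurableSpace S]

/-! ### Tail triviality ⇒ short-range correlations -/

section Mixing

variable [Countable V] {μ : Measure (V → S)} [IsProbabilityMeasure μ]

omit [Countable V] in
/-- **Lévy downward + tail triviality, in `L¹` along a subsequence**: for a tail-trivial `μ`, an
exhausting sequence `Λ_n ↑ V` and a bounded measurable `f`, along some subsequence
`∫ |μ(f | 𝓕_{Λ_nᶜ}) - μ(f)| dμ → 0` (Georgii 2011, Prop. 7.9 with Thm. 7.7(a), proof). [cite: Georgii2011, Prop. 7.9] -/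
theorem IsTailTrivial.exists_strictMono_tendsto_integral_abs_condExp_sub (hμ : IsTailTrivial μ)
    {Λ : ℕ → Finset V} (hΛmono : Monotone Λ) (hΛex : ∀ Δ : Finset V, ∃ n, Δ ⊆ Λ n)
    {f : (V → S) → ℝ} (hf : Integrable f μ) {C : ℝ} (hfC : ∀ x, |f x| ≤ C) :
    ∃ φ : ℕ → ℕ, StrictMono φ ∧
      Tendsto (fun j => ∫ x, |(μ[f|cylinderEvents (X := fun _ : V => S)
        ((↑(Λ (φ j)) : Set V)ᶜ)]) x - ∫ y, f y ∂μ| ∂μ) atTop (𝓝 0) := by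
  set ℱ : ℕ → MeasurableSpace (V → S) :=
    fun n => cylinderEvents (X := fun _ : V => S) ((↑(Λ n) : Set V)ᶜ) with hℱ
  have hℱanti : Antitone ℱ := fun n k hnk =>
    cylinderEvents_mono (Set.compl_subset_compl.2 (Finset.coe_subset.2 (hΛmono hnk)))
  have hℱle : ∀ n, ℱ n ≤ (MeasurableSpace.pi : MeasurableSpace (V → S)) := fun n =>
    cylinderEvents_le_pi
  have hfC' : ∀ᵐ x ∂μ, |f x| ≤ C := Eventually.of_forall hfC
  obtain ⟨φ, hφ, hae⟩ :=
    Process.exists_strictMono_ae_tendsto_condExp_antitone hℱanti hℱle hf hfC'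
  refine ⟨φ, hφ, ?_⟩
  -- the limit is the constant `∫ f`
  have hT : (⨅ n, ℱ n) = tailEvents V S := (tailEvents_eq_iInf_of_exhaustion hΛex).symm
  have hlim : μ[f|⨅ n, ℱ n] =ᵐ[μ] fun _ => ∫ y, f y ∂μ := by
    rw [hT]; exact IsTailTrivial.condExp_tailEvents_ae_eq_const hμ hf
  set c : ℝ := ∫ y, f y ∂μ with hc
  set F : ℕ → (V → S) → ℝ := fun j x => |(μ[f|ℱ (φ j)]) x - c| with hF
  have hFmeas : ∀ j, AEStronglyMeasurable (F j) μ := fun j => by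
    have h1 : AEStronglyMeasurable (μ[f|ℱ (φ j)]) μ :=
      (stronglyMeasurable_condExp.mono (hℱle _)).aestronglyMeasurable
    have h2 : AEStronglyMeasurable (fun x => (μ[f|ℱ (φ j)]) x - c) μ :=
      h1.sub aestronglyMeasurable_const
    exact continuous_abs.comp_aestronglyMeasurable h2
  have hFbound : ∀ j, ∀ᵐ x ∂μ, ‖F j x‖ ≤ C + |c| := fun j => by
    filter_upwards [ae_bdd_abs_condExp_of_ae_bdd_abs (m := ℱ (φ j)) hfC'] with x hx
    rw [hF, Real.norm_eq_abs, abs_abs]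
    exact (abs_sub _ _).trans (add_le_add hx le_rfl)
  have hFlim : ∀ᵐ x ∂μ, Tendsto (fun j => F j x) atTop (𝓝 0) := by
    filter_upwards [hae, hlim] with x hx hxlim
    rw [hxlim] at hx
    have h := (hx.sub_const c).abs
    rwa [sub_self, abs_zero] at h
  have h := tendsto_integral_of_dominated_convergence (fun _ => C + |c|) hFmeas
    (integrable_const _) hFbound hFlim
  simpa [hF] using h

/-- **Tail triviality ⇒ short-range correlations** (Georgii 2011, Prop. 7.9 with Thm. 7.7(a):
`sup_{B ∈ 𝓕_{Λᶜ}} |μ(A ∩ B) - μ(A)μ(B)| → 0` as `Λ ↑ V`): for a tail-trivial probability measure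
`μ` on `V → S`, every event `A` and `ε > 0` there is a finite `Λ ⊆ V` such that
`|μ(A ∩ B) - μ(A) μ(B)| ≤ ε` for every `B ∈ 𝓕_{Λᶜ}`. [cite: Georgii2011, Prop. 7.9] -/
theorem IsTailTrivial.exists_finset_abs_measureReal_inter_sub_le (hμ : IsTailTrivial μ)
    {A : Set (V → S)} (hA : MeasurableSet A) {ε : ℝ} (hε : 0 < ε) :
    ∃ Λ : Finset V, ∀ B : Set (V → S),
      MeasurableSet[cylinderEvents (X := fun _ : V => S) ((↑Λ : Set V)ᶜ)] B →
        |μ.real (A ∩ B) - μ.real A * μ.real B| ≤ ε := by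
  obtain ⟨Λ, hΛmono, hΛex⟩ := exists_monotone_finset_exhaustion V
  set f : (V → S) → ℝ := A.indicator 1 with hf
  have hfint : Integrable f μ := (integrable_const (1 : ℝ)).indicator hA
  have hfC : ∀ x, |f x| ≤ 1 := fun x => by
    simp only [hf, Set.indicator, Pi.one_apply]
    split_ifs <;> simp
  have hc : ∫ y, f y ∂μ = μ.real A := by rw [hf, integral_indicator_one hA]
  obtain ⟨φ, -, hφ⟩ :=
    IsTailTrivial.exists_strictMono_tendsto_integral_abs_condExp_sub hμ hΛmono hΛex hfint hfC
  obtain ⟨j, hj⟩ := ((tendsto_order.1 hφ).2 ε hε).exists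
  refine ⟨Λ (φ j), fun B hB => ?_⟩
  have hmle : cylinderEvents (X := fun _ : V => S) ((↑(Λ (φ j)) : Set V)ᶜ) ≤
      (MeasurableSpace.pi : MeasurableSpace (V → S)) := cylinderEvents_le_pi
  have hBm : MeasurableSet B := hmle _ hB
  set g : (V → S) → ℝ := μ[f|cylinderEvents (X := fun _ : V => S) ((↑(Λ (φ j)) : Set V)ᶜ)]
    with hg
  -- `μ(A ∩ B) = ∫_B g` and `μ(A) μ(B) = ∫_B μ(A)`
  have h1 : μ.real (A ∩ B) = ∫ x in B, g x ∂μ := by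
    rw [hg, setIntegral_condExp hmle hfint hB, hf, setIntegral_indicator hA]
    simp only [Pi.one_apply]
    rw [setIntegral_const, smul_eq_mul, mul_one, Set.inter_comm]
  have h2 : μ.real A * μ.real B = ∫ x in B, (μ.real A) ∂μ := by
    rw [setIntegral_const, smul_eq_mul, mul_comm]
  have hgint : Integrable g μ := integrable_condExp
  have h3 : μ.real (A ∩ B) - μ.real A * μ.real B = ∫ x in B, (g x - μ.real A) ∂μ := by
    rw [h1, h2, ← integral_sub hgint.integrableOn (integrable_const _).integrableOn]
  rw [h3]
  calc |∫ x in B, (g x - μ.real A) ∂μ| ≤ ∫ x in B, |g x - μ.real A| ∂μ :=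
        abs_integral_le_integral_abs
    _ ≤ ∫ x, |g x - μ.real A| ∂μ :=
        setIntegral_le_integral ((hgint.sub (integrable_const _)).abs)
          (Eventually.of_forall fun x => abs_nonneg _)
    _ ≤ ε := by rw [← hc]; exact hj.le

end Mixing

/-! ### Short-range correlations ⇒ ergodicity of dissipative coordinate shifts -/

section Ergodic

variable [Countable V] {μ : Measure (V → S)} [IsProbabilityMeasure μ]

omit [Countable V] in
/-- A cylinder event pulled back along the shift `ω ↦ ω ∘ g` is measurable with respect to the
coordinates in `g(s)`; in particular with respect to `𝓕_{Λᶜ}` when `g(s) ∩ Λ = ∅`. [folklore] -/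
theorem measurableSet_cylinderEvents_preimage_coordShift_cylinder {g : V → V} (s Λ : Finset V)
    (hn : ∀ i ∈ s, g i ∉ Λ) {T : Set (∀ _ : s, S)} (hT : MeasurableSet T) :
    MeasurableSet[cylinderEvents (X := fun _ : V => S) ((↑Λ : Set V)ᶜ)]
      (coordShift (X := S) g ⁻¹' cylinder s T) := by
  have hmeas : Measurable[cylinderEvents (X := fun _ : V => S) ((↑Λ : Set V)ᶜ)]
      fun (ω : V → S) (i : s) => ω (g i) := by
    refine @measurable_pi_lambda _ _ _ (cylinderEvents (X := fun _ : V => S) ((↑Λ : Set V)ᶜ))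
      _ _ fun i => ?_
    exact measurable_cylinderEvent_apply (X := fun _ : V => S)
      (by simpa only [Set.mem_compl_iff, Finset.mem_coe] using hn i i.2)
  exact hmeas hT

/-- **Tail triviality ⇒ ergodicity of dissipative measure-preserving coordinate shifts**
(Georgii 2011, Prop. 14.9 for extremal Gibbs measures; here for any tail-trivial probability
measure): if `μ` is tail trivial and preserved by `ω ↦ ω ∘ g`, where the iterates of `g` move every
finite set of coordinates out of every finite set, then every measurable event invariant under the
shift has probability `0` or `1`. Proof: short-range correlations
(`exists_finset_abs_measureReal_inter_sub_le`) give asymptotic mixing on cylinder events, and the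
tree's `measure_eq_zero_or_one_of_preimage_eq_of_mixing` applies. [cite: Georgii2011, Prop. 14.9] -/
theorem IsTailTrivial.measure_eq_zero_or_one_of_preimage_coordShift_eq (hμ : IsTailTrivial μ)
    {g : V → V} (hT : MeasurePreserving (coordShift (X := S) g) μ μ)
    (hdis : ∀ s Λ : Finset V, ∃ n : ℕ, ∀ i ∈ s, g^[n] i ∉ Λ)
    {A : Set (V → S)} (hA : MeasurableSet A) (hinv : coordShift (X := S) g ⁻¹' A = A) :
    μ A = 0 ∨ μ A = 1 := by
  classical
  refine measure_eq_zero_or_one_of_preimage_eq_of_mixing (C := measurableCylinders fun _ : V => S)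
    isSetRing_measurableCylinders ?_ generateFrom_measurableCylinders.symm hT ?_ hA hinv
  · refine ⟨{Set.univ}, Set.countable_singleton _, ?_, by simp⟩
    rw [Set.singleton_subset_iff]
    exact isSetAlgebra_measurableCylinders.univ_mem
  · intro B hB ε hε
    obtain ⟨s, T, hTm, rfl⟩ := (mem_measurableCylinders B).1 hB
    have hBm : MeasurableSet (cylinder s T : Set (V → S)) := MeasurableSet.cylinder s hTm
    obtain ⟨Λ, hΛ⟩ :=
      IsTailTrivial.exists_finset_abs_measureReal_inter_sub_le hμ hBm (half_pos hε)
    obtain ⟨n, hn⟩ := hdis s Λ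
    refine ⟨n, ?_⟩
    rw [coordShift_iterate]
    have hpre : μ.real (coordShift (X := S) (g^[n]) ⁻¹' cylinder s T) = μ.real (cylinder s T) := by
      have h := (hT.iterate n).measure_preimage hBm.nullMeasurableSet
      rw [coordShift_iterate] at h
      simp only [measureReal_def, h]
    have key := hΛ _ (measurableSet_cylinderEvents_preimage_coordShift_cylinder s Λ hn hTm)
    rw [hpre] at key
    linarith

end Ergodic

/-! ### Lattice shifts on spin configurations -/

section Lattice

variable {d : ℕ}

/-- `configRelabel (Site.shift v)` is the coordinate shift along `x ↦ x - v`. [folklore] -/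
theorem configRelabel_shift_eq_coordShift (v : Site d) :
    (configRelabel (Site.shift v) : SpinConfig (Site d) → SpinConfig (Site d)) =
      coordShift (X := ℤˣ) fun x => x - v := by
  funext σ; funext x
  rw [configRelabel_eq_comp_symm, Function.comp_apply, Site.shift_symm_apply, coordShift_apply]

/-- Iterating `x ↦ x - v`. [folklore] -/
theorem iterate_sub_apply (v : Site d) (n : ℕ) (x : Site d) :
    (fun y : Site d => y - v)^[n] x = x - n • v := by
  induction n with
  | zero => simp
  | succ k ih => rw [Function.iterate_succ_apply', ih, succ_nsmul]; abel

/-- The iterates of a non-zero shift move every finite set out of every finite set. [folklore] -/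
theorem exists_forall_iterate_sub_notMem {v : Site d} (hv : v ≠ 0) (s Λ : Finset (Site d)) :
    ∃ n : ℕ, ∀ x ∈ s, (fun y : Site d => y - v)^[n] x ∉ Λ := by
  obtain ⟨i, hi⟩ : ∃ i, v i ≠ 0 := by
    by_contra h
    push Not at h
    exact hv (funext h)
  -- bounds for the `i`-th coordinates of `s` and `Λ`
  obtain ⟨M, hM⟩ : ∃ M : ℕ, (∀ x ∈ s, |x i| ≤ M) ∧ ∀ y ∈ Λ, |y i| ≤ M := by
    refine ⟨s.sup (fun x => (x i).natAbs) + Λ.sup (fun y => (y i).natAbs), fun x hx => ?_,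
      fun y hy => ?_⟩
    · have h1 : (x i).natAbs ≤ s.sup fun x => (x i).natAbs :=
        Finset.le_sup (f := fun x => (x i).natAbs) hx
      have h2 := (Nat.cast_le (α := ℤ)).2 (h1.trans (Nat.le_add_right _ (Λ.sup fun y => (y i).natAbs)))
      rwa [Nat.cast_natAbs] at h2
    · have h1 : (y i).natAbs ≤ Λ.sup fun y => (y i).natAbs :=
        Finset.le_sup (f := fun y => (y i).natAbs) hy
      have h2 := (Nat.cast_le (α := ℤ)).2 (h1.trans (Nat.le_add_left _ (s.sup fun x => (x i).natAbs)))
      rwa [Nat.cast_natAbs] at h2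
  refine ⟨2 * M + 1, fun x hx hmem => ?_⟩
  rw [iterate_sub_apply] at hmem
  have h1 := hM.1 x hx
  have h2 := hM.2 _ hmem
  simp only [Pi.sub_apply, Pi.smul_apply] at h2
  rw [nsmul_eq_mul] at h2
  push_cast at h2
  have hvi : 1 ≤ |v i| := Int.one_le_abs hi
  have hM0 : (0 : ℤ) ≤ M := Nat.cast_nonneg M
  have h3 : |(2 * (M : ℤ) + 1) * v i| = (2 * M + 1 : ℤ) * |v i| := by
    rw [abs_mul, abs_of_nonneg (by positivity)]
  have h4 : |(2 * (M : ℤ) + 1) * v i| ≤ |x i| + |x i - (2 * (M : ℤ) + 1) * v i| := by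
    have := abs_sub_abs_le_abs_sub ((2 * (M : ℤ) + 1) * v i) (x i)
    rw [abs_sub_comm] at this
    linarith
  rw [h3] at h4
  have h5 : (2 * (M : ℤ) + 1) * 1 ≤ (2 * M + 1) * |v i| :=
    mul_le_mul_of_nonneg_left hvi (by positivity)
  linarith

/-- **An extremal (tail-trivial) state invariant under a non-zero lattice shift is ergodic for it**
(Georgii 2011, Prop. 14.9; used by Georgii–Higuchi 2000, proof of Lemma 3.1, Step 2, for the
subgroup `2ℤ²`): if `μ` on `{±1}^{ℤ^d}` is tail trivial and `μ ∘ (configRelabel (Site.shift v))⁻¹ = μ`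
with `v ≠ 0`, then every measurable `A` with `(configRelabel (Site.shift v))⁻¹ A = A` has
`μ(A) ∈ {0, 1}`. [cite: Georgii2011, Prop. 14.9] [cite: GeorgiiHiguchi2000, Lemma 3.1 (proof, Step 2, p. 7)] -/
theorem IsTailTrivial.measure_eq_zero_or_one_of_shift_invariant {μ : Measure (SpinConfig (Site d))}
    [IsProbabilityMeasure μ] (hμ : IsTailTrivial μ) {v : Site d} (hv : v ≠ 0)
    (hμv : μ.map (configRelabel (Site.shift v)) = μ) {A : Set (SpinConfig (Site d))}
    (hA : MeasurableSet A) (hinv : (configRelabel (Site.shift v)) ⁻¹' A = A) :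
    μ A = 0 ∨ μ A = 1 := by
  rw [configRelabel_shift_eq_coordShift] at hμv hinv
  have hT : MeasurePreserving (coordShift (X := ℤˣ) fun x : Site d => x - v) μ μ :=
    ⟨measurable_coordShift _, hμv⟩
  exact IsTailTrivial.measure_eq_zero_or_one_of_preimage_coordShift_eq hμ hT
    (exists_forall_iterate_sub_notMem hv) hA hinv

end Lattice

end Literature.Probability.LatticeModels
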